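import Summits.CriticalPhenomena.Ising3DConformalLimit.Theses.HelsonAxis
import Summits.CriticalPhenomena.Ising3DConformalLimit.Theorems.HyperoctahedralRPHRP2Rigidity

/-!
# Crux `HelsonAxis.AxisToIsotropicLaw` (stmt-CriticalPhenomena-17971) — birth skeleton `Lines/birth.lean` (BC3)

Skeleton-registrar seat `planner-skel-stmt-CriticalPhenomena-17971-0`, 2026-08-17 (route
`route-CriticalPhenomena-HelsonAxis`, rank-3 crux; route re-audit bin HONEST; BC3 of
`run/shared/lean/lens3/_common/BC.md`). Line card: `Lines/birth.md`.

THE CRUX. Write `G := criticalTwoPoint 3`, `g(n) := G(n e₀)`, `|x|₂ := √(∑ xᵢ²)`. `AxisToIsotropicLaw` says: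
`(∃ Δ A, 0 < A ∧ g(n)·n^{2Δ} → A) → (∃ Δ' c, 0 < c ∧ G(x)·|x|₂^{2Δ'} → c cofinitely on ℤ³)` — the axial pure power
law WITH amplitude propagates off the axis to the rotation-invariant cofinite law (the conclusion is item 0634
`IsingEuclidUpgradeR2RotInvPowerLaw` verbatim; given the hypothesis `Δ' = Δ`, `c = A` are forced). Its content is
off-axis EXISTENCE of the angular amplitude and its ISOTROPY (refuter note 2026-08-17: "the whole content is existence +
constancy of the angular amplitude a(u) = lim_t G([tu]) t^{2Δ}").

THE CUT (four stubs; isotropy is DISCHARGED by a landed theorem, the open content is purely radial). Rescale by the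
axial law: `R_δ(y) := δ^{-2Δ} G([y/δ])`, `y ∈ ℝ³`, `[·/δ] = latticeApprox δ`. A CLUSTER KERNEL is a locally uniform
limit `F` of `R_{δ_k}` on `ℝ³∖{0}` along some `δ_k → 0⁺`, normalised by `F 0 = 0` (`IsClusterKernel`).
* T1 `TwoPointPrecompactness` / `stub_precompactness` — PROVABLE NOW (L/XL): under the axial law every `δ_k → 0⁺` has a
  subsequence along which `R_δ` converges locally uniformly on `ℝ³∖{0}`. Inputs, all LANDED: the axial law gives
  all-scale doubling `g(2n) ≥ κ g(n)` (statement of item 6150, here a consequence); `MirrorHoelderCompactness.SeparableHoelder`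
  (item 6151: Hölder-½ modulus of the `ρ★`-rescaled correlator under one-point moves at nine-separable configurations —
  at `n = 2` EVERY `(0, y)`, `y ≠ 0`, is separable by the coordinate normal carrying `‖y‖_∞`) and
  `MirrorHoelderCompactness.RescaledBounds` (item 6157: two-sided bounds on compacts); or directly the every-direction
  unit-step bound from `NineMirrorGradient` (item 6156) + doubling + MMS. Arzelà–Ascoli with an `O(√δ)` equicontinuity
  defect on annuli, diagonal extraction; `ρ★(δ)² = 1/g(⌊1/δ⌋)` and `δ^{-2Δ}` differ by a factor `→ A`.
* T2 `ClusterKernelInheritance` / `stub_inheritance` — PROVABLE NOW (M/L): under the axial law every cluster kernel has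
  `1/2 ≤ Δ ≤ 1` (envelope `c‖x‖⁻² ≤ G ≤ C‖x‖⁻¹`, `criticalTwoPoint_bounds_holds`), is continuous off `0` (the modulus of
  6151 passes to the limit), positive off `0` (lower bound of 6157), axis-normalised `F(t e₀) = A t^{-2Δ}` (the axial law),
  and nine-mirror INVARIANT (signed-permutation symmetry `twoPointPlus_signedPerm`) and REFLECTION POSITIVE (finite RP sums
  of the landed `CriticalCorrNineMirrorRP`, item 1985, all `k_a = 1`, via `criticalCorr_two` + translation invariance, at
  the lattice points `[p_a/δ_k]`, passed to the limit by local uniform convergence at moving points + continuity).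
* T3 `ZoomHomogeneity` / `stub_zoomHomogeneity` — OPEN, THE HEART: under the axial law every cluster kernel is homogeneous
  of degree `-2Δ`. Equivalently the zoom dynamics `F ↦ c^{2Δ}F(c·)` on the (compact, zoom-invariant) cluster set is
  trivial; equivalently RADIAL scale covariance OFF the axis (no wandering / log-periodic modulation of the amplitude in
  any off-axis direction, given its absence on the axis). NO isotropy is asserted and none is needed from it.
* T4 `SubsequencePrinciple` / `stub_subsequencePrinciple` — PROVABLE NOW (M): precompactness + "every cluster kernel is
  `A‖y‖^{-2Δ}`" ⇒ `G(x)|x|₂^{2Δ} → A` cofinitely (contradiction along `δ_k = 1/|x_k|₂`, `u_k = x_k/|x_k|₂ → u` on the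
  sphere, `[u_k/δ_k] = x_k` exactly, local uniform convergence + continuity of the limit at `u`).
COMPOSITION `AxisToIsotropicLaw_of : T1 → T2 → T3 → T4 → AxisToIsotropicLaw` (kernel-checked, NO sorry, axioms
`[propext, Classical.choice, Quot.sound]`): for every cluster kernel, T2 + T3 are exactly the hypotheses of the LANDED
nine-mirror RP rigidity `HyperoctahedralRP.HRP2Rigidity` (item 1979, `Cruxes.HRP2Rigidity.XRayMellin.HRP2Rigidity_of`,
2026-08-16), so `F` is invariant under all linear isometries; the readout `kernel_eq_of_rot_hom` (PROVED here: two unit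
vectors are exchanged by a reflection, `Submodule.reflection_sub`) gives `F = ‖·‖^{-2Δ}F(e₀) = A‖·‖^{-2Δ}`; T4 concludes
with the witnesses `(Δ, A)`. Hypotheses = the registered stubs BY NAME through the aliases `__Registered.stub_…`
(device of `Cruxes/TwoPointRegularVariation/Lines/birth.lean`).

LOSSLESS: crux ⇒ T3 (the crux's conclusion restricted to the axis forces `(Δ', c) = (Δ, A)`; then `R_{δ_k} → A‖·‖^{-2Δ}`
pointwise off `0`, so every cluster kernel is that homogeneous kernel); T1, T2, T4 are theorems-to-be from landed inputs.
So, GIVEN THE TREE, `AxisToIsotropicLaw ⟺ T3`: the off-axis transfer principle of the route is a purely RADIAL statement —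
rotation invariance costs nothing beyond items 1979/1985/6151/6157 — which is where the route's own lever (multiplicative
/ Helson positivity along rays, `AxialHelsonCone`, `HelsonForcing`) can bite off the axis too.

COARSER CUT kept in the seat folder (`bc/AxisToIsotropicLaw_birth.lean`, rc 0): S1 `ProfileFromAxis` (axial law ⇒ a
continuous positive homogeneous profile `K` with `G/K → 1` cofinitely; = T1+T3+uniqueness lumped) + S2 `ProfileInheritance`
(window + nine-mirror inheritance of the profile) + S3 `LawOfIsotropicProfile` (PROVED there, `bc/scratch_s3.lean` rc 0).
Superseded by the present cut, which isolates the open heart T3. SIBLING LINES on the conclusion node 0634: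
`Cruxes/IsingEuclidUpgradeR2RotInvPowerLaw/Lines/{dyadic_dini_isotropy,tower_profile_rigidity}.lean` (stubs A
`stub_angularProfile`, R `stub_rigidityTransfer`, Sray/Rray) — same architecture (profile/ray law + inheritance + 1979);
their variant-Q reading "the open content of r2 is purely radial" is confirmed here at the level of the HelsonAxis crux.

DISPROOF USED: none exists — `ledger crux ls stmt-CriticalPhenomena-17971`: no workfiles (no `Disproof.lean`, no
`_false_without_`, no `Negative/`) at registration; `ledger negatives --problem CriticalPhenomena` (11 entries,
2026-08-17): all Cardy/SAW/percolation, none in this sub-problem, none resembling a stub. The refuter's crux-attack note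
(item notes, 2026-08-17T10:01Z: guard `0 < A` load-bearing; `Δ' = Δ`, `c = A` forced; content = existence + constancy
of the angular amplitude; HRP2Rigidity applicable "if a continuous nine-mirror-RP homogeneous kernel can be extracted") is
honoured literally: T1/T2 extract the kernel(s), T3 is the homogeneity, 1979 the constancy.

CHECKS (farm, 2026-08-17): `lean check` rc 0, errors [], sorries 4 = `stub_precompactness`, `stub_inheritance`,
`stub_zoomHomogeneity`, `stub_subsequencePrinciple` (sorry count 4 = stub count 4, zero elsewhere); `#print axioms
AxisToIsotropicLaw_of` = `[propext, Classical.choice, Quot.sound]`. BC3 PROBES (seat folder `bc/probe_stub_*.lean`;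
adversarial scope: route file AND `Theorems/HyperoctahedralRPHRP2Rigidity` imported; antecedent = stub statement
verbatim; `maxHeartbeats 400000`): for each of the 4 stubs, `stub → AxisToIsotropicLaw` and `stub → Ising3DConformalLimit`
by `first | exact? | simpa | aesop`, plus the unfolded-target variants — 16/16 FAIL (13 `unsolved goals` with `aesop: failed
to prove the goal after exhaustive search`, 3 deterministic time-outs; single-tactic re-runs of those 3: `exact?` "could not
close the goal" 3/3, `simpa` type mismatch 3/3, `aesop` exhaustive failure 2/3 at 1.6 M heartbeats and time-out 1/3).
No stub is cheaply the crux or the summit: T1 is compactness only, T2 lists inherited structure of hypothetical limits,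
T3 is homogeneity only (no isotropy, no cofinite law), T4 is conditional on the identification of every cluster kernel.
-/

noncomputable section

namespace Summit.CriticalPhenomena.Ising3DConformalLimit.Cruxes.AxisToIsotropicLaw.Birth

open Filter Topology Literature.Probability.LatticeModels
open Summit.CriticalPhenomena.Ising3DConformalLimit.Theses

/-! ## Vocabulary (plain `def`s; the stubs below repeat them verbatim, expanded) -/

/-- The axial pure power law AT exponent `Δ` with amplitude `A`:
`⟨σ₀σ_{n e₀}⟩_{β_c(3)} · n^{2Δ} → A` (the crux's hypothesis, witnesses exposed). -/
def AxisLawAt (Δ A : ℝ) : Prop :=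
  Filter.Tendsto (fun n : ℕ => Literature.Probability.LatticeModels.criticalTwoPoint 3 (Pi.single (0 : Fin 3) (n : ℤ)) * (n : ℝ) ^ (2 * Δ)) Filter.atTop (nhds A)

/-- `F` is a CLUSTER KERNEL at exponent `Δ`: normalised by `F 0 = 0`, it is the locally uniform limit
on `ℝ³ ∖ {0}` of the rescaled two-point function `y ↦ δ^{-2Δ} ⟨σ₀σ_{[y/δ]}⟩_{β_c(3)}` along SOME sequence
of meshes `δ_k → 0⁺` (a subsequential scaling limit of the two-point function, in the normalisation the
axial law dictates). -/
def IsClusterKernel (Δ : ℝ) (F : EuclideanSpace ℝ (Fin 3) → ℝ) : Prop :=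
  F 0 = 0 ∧ ∃ δ : ℕ → ℝ, (∀ k, 0 < δ k) ∧ Filter.Tendsto δ Filter.atTop (nhds 0) ∧
    TendstoLocallyUniformlyOn (fun (k : ℕ) (y : EuclideanSpace ℝ (Fin 3)) => (δ k) ^ (-(2 * Δ)) * Literature.Probability.LatticeModels.criticalTwoPoint 3 (Literature.Probability.LatticeModels.latticeApprox (δ k) y)) F Filter.atTop {0}ᶜ

/-- PRECOMPACTNESS of the rescaled two-point family at exponent `Δ`: every sequence of meshes
`δ_k → 0⁺` has a subsequence along which `y ↦ δ^{-2Δ}⟨σ₀σ_{[y/δ]}⟩` converges locally uniformly on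
`ℝ³ ∖ {0}` (to a cluster kernel). -/
def Precompact (Δ : ℝ) : Prop :=
  ∀ δ : ℕ → ℝ, (∀ k, 0 < δ k) → Filter.Tendsto δ Filter.atTop (nhds 0) →
    ∃ (φ : ℕ → ℕ) (F : EuclideanSpace ℝ (Fin 3) → ℝ), StrictMono φ ∧ F 0 = 0 ∧
      TendstoLocallyUniformlyOn (fun (k : ℕ) (y : EuclideanSpace ℝ (Fin 3)) => (δ (φ k)) ^ (-(2 * Δ)) * Literature.Probability.LatticeModels.criticalTwoPoint 3 (Literature.Probability.LatticeModels.latticeApprox (δ (φ k)) y)) F Filter.atTop {0}ᶜ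

/-- The nine-mirror clause of `HyperoctahedralRP.HRP2Rigidity`, verbatim: invariance AND reflection
positivity of the finite sums `Σ c_a c_b F(p_a − θ_n p_b)`, `⟨p_a, n⟩ > 0`, for the nine lattice mirror
normals `n ∈ {e_i, e_i + e_j, e_i − e_j}`. -/
def NineMirror (F : EuclideanSpace ℝ (Fin 3) → ℝ) : Prop :=
  ∀ n : EuclideanSpace ℝ (Fin 3), (∃ i j : Fin 3, i ≠ j ∧ (n = EuclideanSpace.single i 1 ∨ n = EuclideanSpace.single i 1 + EuclideanSpace.single j 1 ∨ n = EuclideanSpace.single i 1 - EuclideanSpace.single j 1)) → (∀ x, F (((ℝ ∙ n)ᗮ).reflection x) = F x) ∧ (∀ (m : ℕ) (p : Fin m → EuclideanSpace ℝ (Fin 3)) (c : Fin m → ℝ), (∀ a, 0 < inner ℝ (p a) n) → 0 ≤ ∑ a, ∑ b, c a * c b * F (p a - ((ℝ ∙ n)ᗮ).reflection (p b)))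

/-! ## The four statements of the line, named -/

/-- **T1 `TwoPointPrecompactness` (PROVABLE NOW, size L/XL, from landed theorems).** Under the axial law the
rescaled two-point family is precompact in `C_loc(ℝ³∖{0})`. Route: the axial law gives all-scale
DOUBLING `g(2n) ≥ κ g(n)` (item 6150's statement, here a consequence); then the LANDED
`MirrorHoelderCompactness.SeparableHoelder` (item 6151: Hölder-½ modulus of the rescaled correlator under
one-point moves at nine-separable configurations — at `n = 2` EVERY configuration `(0, y)`, `y ≠ 0`, is
separable) and `MirrorHoelderCompactness.RescaledBounds` (item 6157: two-sided bounds on compacts) make the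
family bounded and asymptotically equicontinuous on compact annuli; diagonal extraction (Arzelà–Ascoli
with an `O(√δ)` defect) gives the subsequence; the `ρ★`-normalisation of those items and the `δ^{-2Δ}` one
here differ by a factor tending to `A`. -/
def TwoPointPrecompactness : Prop :=
  ∀ Δ A : ℝ, 0 < A → AxisLawAt Δ A → Precompact Δ

/-- **T2 `ClusterKernelInheritance` (PROVABLE NOW, size M/L).** Under the axial law every cluster kernel `F` has:
the exponent window `1/2 ≤ Δ ≤ 1` (envelope `c‖x‖⁻² ≤ G ≤ C‖x‖⁻¹`, `criticalTwoPoint_bounds_holds`);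
continuity off `0` (the Hölder modulus of item 6151 passes to the limit); positivity off `0` (lower bound
of item 6157); the axis normalisation `F(t e₀) = A t^{-2Δ}` (the axial law itself); invariance under the
nine lattice mirrors (signed-permutation symmetry `twoPointPlus_signedPerm`) and nine-mirror reflection
positivity (finite RP sums of the LANDED `CriticalCorrNineMirrorRP` (item 1985) with all `k_a = 1`, read
through `criticalCorr_two` and translation invariance, evaluated at `[p_a/δ_k]` and passed to the limit). -/
def ClusterKernelInheritance : Prop :=
  ∀ Δ A : ℝ, 0 < A → AxisLawAt Δ A → ∀ F : EuclideanSpace ℝ (Fin 3) → ℝ, IsClusterKernel Δ F →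
    (1/2 ≤ Δ ∧ Δ ≤ 1) ∧ ContinuousOn F {0}ᶜ ∧ (∀ x, x ≠ 0 → 0 < F x) ∧
    (∀ t : ℝ, 0 < t → F (t • EuclideanSpace.single 0 1) = A * t ^ (-(2 * Δ))) ∧ NineMirror F

/-- **T3 `ZoomHomogeneity` (OPEN — the heart of the crux).** Under the axial law every cluster kernel is
HOMOGENEOUS of degree `-2Δ`: `F(c•x) = c^{-2Δ} F(x)` for `c > 0` (at `x = 0` by the normalisation
`F 0 = 0`). Equivalently: the zoom dynamics `F ↦ c^{2Δ}F(c·)` on the (compact, zoom-invariant) cluster set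
is trivial; equivalently, RADIAL scale covariance off the axis — no wandering / log-periodic modulation of
the amplitude along any off-axis direction, given its absence on the axis. No isotropy is asserted. -/
def ZoomHomogeneity : Prop :=
  ∀ Δ A : ℝ, 0 < A → AxisLawAt Δ A → ∀ F : EuclideanSpace ℝ (Fin 3) → ℝ, IsClusterKernel Δ F →
    ∀ c : ℝ, 0 < c → ∀ x, F (c • x) = c ^ (-(2 * Δ)) * F x

/-- **T4 `SubsequencePrinciple` (PROVABLE NOW, size M).** If the rescaled family is precompact and EVERY
cluster kernel is the isotropic pure power `A‖y‖^{-2Δ}`, then `⟨σ₀σ_x⟩_{β_c}·|x|₂^{2Δ} → A` along the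
cofinite filter of `ℤ³` (argue by contradiction along `δ_k = 1/|x_k|₂`, `u_k = x_k/|x_k|₂ → u` on the unit
sphere; `[u_k/δ_k] = x_k` exactly; locally uniform convergence + continuity of the limit at `u`). -/
def SubsequencePrinciple : Prop :=
  ∀ Δ A : ℝ, 0 < A → AxisLawAt Δ A → Precompact Δ →
    (∀ F : EuclideanSpace ℝ (Fin 3) → ℝ, IsClusterKernel Δ F → ∀ y, y ≠ 0 → F y = A * ‖y‖ ^ (-(2 * Δ))) →
    Filter.Tendsto (fun x : Literature.Probability.LatticeModels.Site 3 => Literature.Probability.LatticeModels.criticalTwoPoint 3 x * Real.sqrt (∑ i, ((x i : ℝ)) ^ 2) ^ (2 * Δ)) Filter.cofinite (nhds A)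

/-! ## The registered stubs (the only `sorry`s of the file), statements written out in full -/

/-- **STUB T1** — `TwoPointPrecompactness`, written out (provable now from items 6151/6157 + doubling from the
axial law; Arzelà–Ascoli with an `O(√δ)` equicontinuity defect). -/
theorem stub_precompactness :
    ∀ Δ A : ℝ, 0 < A →
      Filter.Tendsto (fun n : ℕ => Literature.Probability.LatticeModels.criticalTwoPoint 3 (Pi.single (0 : Fin 3) (n : ℤ)) * (n : ℝ) ^ (2 * Δ)) Filter.atTop (nhds A) →
      ∀ δ : ℕ → ℝ, (∀ k, 0 < δ k) → Filter.Tendsto δ Filter.atTop (nhds 0) →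
        ∃ (φ : ℕ → ℕ) (F : EuclideanSpace ℝ (Fin 3) → ℝ), StrictMono φ ∧ F 0 = 0 ∧
          TendstoLocallyUniformlyOn (fun (k : ℕ) (y : EuclideanSpace ℝ (Fin 3)) => (δ (φ k)) ^ (-(2 * Δ)) * Literature.Probability.LatticeModels.criticalTwoPoint 3 (Literature.Probability.LatticeModels.latticeApprox (δ (φ k)) y)) F Filter.atTop {0}ᶜ := by
  sorry

/-- **STUB T2** — `ClusterKernelInheritance`, written out (provable now: window, continuity, positivity, axis
normalisation, nine-mirror invariance and RP of every cluster kernel). -/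
theorem stub_inheritance :
    ∀ Δ A : ℝ, 0 < A →
      Filter.Tendsto (fun n : ℕ => Literature.Probability.LatticeModels.criticalTwoPoint 3 (Pi.single (0 : Fin 3) (n : ℤ)) * (n : ℝ) ^ (2 * Δ)) Filter.atTop (nhds A) →
      ∀ F : EuclideanSpace ℝ (Fin 3) → ℝ,
        (F 0 = 0 ∧ ∃ δ : ℕ → ℝ, (∀ k, 0 < δ k) ∧ Filter.Tendsto δ Filter.atTop (nhds 0) ∧
          TendstoLocallyUniformlyOn (fun (k : ℕ) (y : EuclideanSpace ℝ (Fin 3)) => (δ k) ^ (-(2 * Δ)) * Literature.Probability.LatticeModels.criticalTwoPoint 3 (Literature.Probability.LatticeModels.latticeApprox (δ k) y)) F Filter.atTop {0}ᶜ) →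
        (1/2 ≤ Δ ∧ Δ ≤ 1) ∧ ContinuousOn F {0}ᶜ ∧ (∀ x, x ≠ 0 → 0 < F x) ∧
        (∀ t : ℝ, 0 < t → F (t • EuclideanSpace.single 0 1) = A * t ^ (-(2 * Δ))) ∧
        (∀ n : EuclideanSpace ℝ (Fin 3), (∃ i j : Fin 3, i ≠ j ∧ (n = EuclideanSpace.single i 1 ∨ n = EuclideanSpace.single i 1 + EuclideanSpace.single j 1 ∨ n = EuclideanSpace.single i 1 - EuclideanSpace.single j 1)) → (∀ x, F (((ℝ ∙ n)ᗮ).reflection x) = F x) ∧ (∀ (m : ℕ) (p : Fin m → EuclideanSpace ℝ (Fin 3)) (c : Fin m → ℝ), (∀ a, 0 < inner ℝ (p a) n) → 0 ≤ ∑ a, ∑ b, c a * c b * F (p a - ((ℝ ∙ n)ᗮ).reflection (p b)))) := by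
  sorry

/-- **STUB T3** — `ZoomHomogeneity`, written out (OPEN; the hardest stub: homogeneity of every cluster
kernel, i.e. radial scale covariance off the axis). -/
theorem stub_zoomHomogeneity :
    ∀ Δ A : ℝ, 0 < A →
      Filter.Tendsto (fun n : ℕ => Literature.Probability.LatticeModels.criticalTwoPoint 3 (Pi.single (0 : Fin 3) (n : ℤ)) * (n : ℝ) ^ (2 * Δ)) Filter.atTop (nhds A) →
      ∀ F : EuclideanSpace ℝ (Fin 3) → ℝ,
        (F 0 = 0 ∧ ∃ δ : ℕ → ℝ, (∀ k, 0 < δ k) ∧ Filter.Tendsto δ Filter.atTop (nhds 0) ∧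
          TendstoLocallyUniformlyOn (fun (k : ℕ) (y : EuclideanSpace ℝ (Fin 3)) => (δ k) ^ (-(2 * Δ)) * Literature.Probability.LatticeModels.criticalTwoPoint 3 (Literature.Probability.LatticeModels.latticeApprox (δ k) y)) F Filter.atTop {0}ᶜ) →
        ∀ c : ℝ, 0 < c → ∀ x, F (c • x) = c ^ (-(2 * Δ)) * F x := by
  sorry

/-- **STUB T4** — `SubsequencePrinciple`, written out (provable now: precompactness + identification of
every cluster kernel ⇒ convergence along the whole cofinite filter, read on the unit sphere). -/
theorem stub_subsequencePrinciple :
    ∀ Δ A : ℝ, 0 < A →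
      Filter.Tendsto (fun n : ℕ => Literature.Probability.LatticeModels.criticalTwoPoint 3 (Pi.single (0 : Fin 3) (n : ℤ)) * (n : ℝ) ^ (2 * Δ)) Filter.atTop (nhds A) →
      (∀ δ : ℕ → ℝ, (∀ k, 0 < δ k) → Filter.Tendsto δ Filter.atTop (nhds 0) →
        ∃ (φ : ℕ → ℕ) (F : EuclideanSpace ℝ (Fin 3) → ℝ), StrictMono φ ∧ F 0 = 0 ∧
          TendstoLocallyUniformlyOn (fun (k : ℕ) (y : EuclideanSpace ℝ (Fin 3)) => (δ (φ k)) ^ (-(2 * Δ)) * Literature.Probability.LatticeModels.criticalTwoPoint 3 (Literature.Probability.LatticeModels.latticeApprox (δ (φ k)) y)) F Filter.atTop {0}ᶜ) →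
      (∀ F : EuclideanSpace ℝ (Fin 3) → ℝ,
        (F 0 = 0 ∧ ∃ δ : ℕ → ℝ, (∀ k, 0 < δ k) ∧ Filter.Tendsto δ Filter.atTop (nhds 0) ∧
          TendstoLocallyUniformlyOn (fun (k : ℕ) (y : EuclideanSpace ℝ (Fin 3)) => (δ k) ^ (-(2 * Δ)) * Literature.Probability.LatticeModels.criticalTwoPoint 3 (Literature.Probability.LatticeModels.latticeApprox (δ k) y)) F Filter.atTop {0}ᶜ) →
        ∀ y, y ≠ 0 → F y = A * ‖y‖ ^ (-(2 * Δ))) →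
      Filter.Tendsto (fun x : Literature.Probability.LatticeModels.Site 3 => Literature.Probability.LatticeModels.criticalTwoPoint 3 x * Real.sqrt (∑ i, ((x i : ℝ)) ^ 2) ^ (2 * Δ)) Filter.cofinite (nhds A) := by
  sorry

/-! ## Aliases keyed by the registered stub names (device of `Cruxes/TwoPointRegularVariation/Lines/birth.lean`)

`__Registered.stub_X` is the statement of `stub_X` under the stub's short name, so that the native skeleton
audit (`#h21_check_skeleton`: hypotheses admissible iff registered obligations / declared stubs BY NAME)
accepts `AxisToIsotropicLaw_of : __Registered.stub_… → … → AxisToIsotropicLaw`. -/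
namespace __Registered

/-- Alias of `TwoPointPrecompactness` keyed by the registered stub name. -/
abbrev stub_precompactness : Prop := TwoPointPrecompactness
/-- Alias of `ClusterKernelInheritance` keyed by the registered stub name. -/
abbrev stub_inheritance : Prop := ClusterKernelInheritance
/-- Alias of `ZoomHomogeneity` keyed by the registered stub name. -/
abbrev stub_zoomHomogeneity : Prop := ZoomHomogeneity
/-- Alias of `SubsequencePrinciple` keyed by the registered stub name. -/
abbrev stub_subsequencePrinciple : Prop := SubsequencePrinciple

end __Registered

/-! ## Tree input: nine-mirror RP rigidity (item stmt-CriticalPhenomena-1979, PROVED 2026-08-16) -/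

/-- `HyperoctahedralRP.HRP2Rigidity` holds — the landed theorem
`Cruxes.HRP2Rigidity.XRayMellin.HRP2Rigidity_of` (`Theorems/HyperoctahedralRPHRP2Rigidity.lean`): a
continuous positive kernel on `ℝ³∖{0}`, homogeneous of degree `-2Δ`, `1/2 ≤ Δ ≤ 1`, invariant and
reflection positive for the nine lattice mirrors, is invariant under every linear isometry.
[cite: FrohlichEtAl1978, §3 Thm 3.1] -/
theorem hrp2Rigidity_holds : HyperoctahedralRP.HRP2Rigidity :=
  Summit.CriticalPhenomena.Ising3DConformalLimit.Cruxes.HRP2Rigidity.XRayMellin.HRP2Rigidity_of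

/-! ## Glue proved here (no sorry): an `O(3)`-invariant homogeneous kernel is `F(e)‖x‖^{-2Δ}` -/

local notation "E3" => EuclideanSpace ℝ (Fin 3)

/-- Two unit vectors are exchanged by a linear isometry (the reflection in `(ℝ ∙ (e − u))ᗮ`, or the
identity). [folklore] -/
theorem exists_isometry_map_unit (e u : E3) (he : ‖e‖ = 1) (hu : ‖u‖ = 1) :
    ∃ R : E3 ≃ₗᵢ[ℝ] E3, R e = u := by
  by_cases heu : e = u
  · exact ⟨LinearIsometryEquiv.refl ℝ E3, by simp [heu]⟩
  · exact ⟨(ℝ ∙ (e - u))ᗮ.reflection, Submodule.reflection_sub (by rw [he, hu])⟩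

/-- **Rigidity readout.** A kernel homogeneous of degree `-2Δ` and invariant under all linear
isometries of `ℝ³` equals `‖x‖^{-2Δ}·F(e)` off the origin, for any unit vector `e`. [folklore] -/
theorem kernel_eq_of_rot_hom (Δ : ℝ) (F : E3 → ℝ)
    (hhom : ∀ c : ℝ, 0 < c → ∀ x, F (c • x) = c ^ (-(2 * Δ)) * F x)
    (hrot : ∀ (R : E3 ≃ₗᵢ[ℝ] E3) (x : E3), F (R x) = F x)
    (e : E3) (he : ‖e‖ = 1) (x : E3) (hx : x ≠ 0) :
    F x = ‖x‖ ^ (-(2 * Δ)) * F e := by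
  have hnx : 0 < ‖x‖ := norm_pos_iff.2 hx
  set u : E3 := ‖x‖⁻¹ • x with hu_def
  have hu : ‖u‖ = 1 := by
    rw [hu_def, norm_smul, norm_inv, norm_norm, inv_mul_cancel₀ hnx.ne']
  obtain ⟨R, hR⟩ := exists_isometry_map_unit e u he hu
  have hx' : ‖x‖ • u = x := by
    rw [hu_def, smul_smul, mul_inv_cancel₀ hnx.ne', one_smul]
  calc F x = F (‖x‖ • u) := by rw [hx']
    _ = ‖x‖ ^ (-(2 * Δ)) * F u := hhom _ hnx u
    _ = ‖x‖ ^ (-(2 * Δ)) * F e := by rw [← hR, hrot]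

/-! ## Composition: the stubs conclude the crux BY NAME (kernel-checked, no sorry) -/

/-- **The skeleton theorem.** `T1 → T2 → T3 → T4 → HelsonAxis.AxisToIsotropicLaw`: take `Δ, A` from
the axial law; T1 makes the rescaled two-point family precompact; for every cluster kernel `F`, T2
supplies the window, continuity, positivity, the axis normalisation `F(e₀) = A` and the nine-mirror
invariance/RP, and T3 supplies homogeneity — so the LANDED rigidity `HRP2Rigidity` makes `F` invariant
under all linear isometries and the readout gives `F = A‖·‖^{-2Δ}`; T4 turns "precompact + every cluster
kernel identified" into the cofinite law `⟨σ₀σ_x⟩·|x|₂^{2Δ} → A`, i.e. the crux's conclusion with the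
witnesses `(Δ, A)`. -/
theorem AxisToIsotropicLaw_of (h1 : __Registered.stub_precompactness) (h2 : __Registered.stub_inheritance)
    (h3 : __Registered.stub_zoomHomogeneity) (h4 : __Registered.stub_subsequencePrinciple) :
    Summit.CriticalPhenomena.Ising3DConformalLimit.Theses.HelsonAxis.AxisToIsotropicLaw := by
  unfold __Registered.stub_precompactness TwoPointPrecompactness at h1
  unfold __Registered.stub_inheritance ClusterKernelInheritance at h2
  unfold __Registered.stub_zoomHomogeneity ZoomHomogeneity at h3
  unfold __Registered.stub_subsequencePrinciple SubsequencePrinciple at h4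
  rintro ⟨Δ, A, hA, hlaw⟩
  have hlaw' : AxisLawAt Δ A := hlaw
  refine ⟨Δ, A, hA, h4 Δ A hA hlaw' (h1 Δ A hA hlaw') ?_⟩
  intro F hF y hy
  obtain ⟨⟨hΔ1, hΔ2⟩, hcont, hpos, haxis, hmir⟩ := h2 Δ A hA hlaw' F hF
  have hhomF := h3 Δ A hA hlaw' F hF
  -- nine-mirror RP rigidity (item 1979, landed): `F` is invariant under every linear isometry
  have hrot := hrp2Rigidity_holds Δ F hΔ1 hΔ2 hcont hpos hhomF hmir
  -- readout at the unit vector `e₀`, where the axial law pins the amplitude: `F e₀ = A`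
  have he : ‖(EuclideanSpace.single (0 : Fin 3) (1 : ℝ) : E3)‖ = 1 := by simp
  have hFe : F (EuclideanSpace.single (0 : Fin 3) (1 : ℝ)) = A := by
    have h1' := haxis 1 one_pos
    rwa [one_smul, Real.one_rpow, mul_one] at h1'
  rw [kernel_eq_of_rot_hom Δ F hhomF hrot _ he y hy, hFe, mul_comm]

/-- The crux from the registered stubs, applied literally (an `example`, so that no sorry-tainted witness
of the crux enters the environment; it checks that statements, aliases and stubs agree textually). -/
example : Summit.CriticalPhenomena.Ising3DConformalLimit.Theses.HelsonAxis.AxisToIsotropicLaw :=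
  AxisToIsotropicLaw_of stub_precompactness stub_inheritance stub_zoomHomogeneity stub_subsequencePrinciple

end Summit.CriticalPhenomena.Ising3DConformalLimit.Cruxes.AxisToIsotropicLaw.Birth

end
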